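import Mathlib.FieldTheory.Perfect
import Mathlib.Order.Filter.Ultrafilter.Basic
import Mathlib.Algebra.CharP.Pi
import Mathlib.RingTheory.Ideal.Quotient.Basic
import HarnessLib

/-!
# UltraWalkField — the ultraproduct of a family of (perfect) fields along an ultrafilter

NODE «UltraWalk» (decomp-res lens-3, gen 30), file 1/4: the FIELD layer of the ŁOŚ TRANSFER used to decide the
certified cell of the typed port `UniformWalks.CompactnessPort` (Theorems/UniformWalkClasses).

For a family of fields `K : ℕ → Type` and an ultrafilter `U` on `ℕ` we build, by hand and instance-light,

* `nullIdeal K U` — the ideal of `Π B, K B` of families vanishing `U`-almost everywhere; it is MAXIMAL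
  (`nullIdeal_isMaximal`), so the quotient `Ultra K U := (Π B, K B) ⧸ nullIdeal K U` is a field;
* the quotient map `Ultra.mk : (Π B, K B) →+* Ultra K U` with the two ŁOŚ rules for atomic formulas
  `mk f = mk g ↔ ∀ᶠ B in U, f B = g B` (`Ultra.mk_eq_mk_iff`) and `mk f ≠ 0 ↔ ∀ᶠ B in U, f B ≠ 0` (`Ultra.mk_ne_zero_iff`);
* characteristic `p` (`Ultra.charP`) and perfectness (`Ultra.perfectField`) when every `K B` is perfect of characteristic `p`;
* the finite-range constancy lemma `Ultrafilter.exists_eventually_eq_of_finite` (a `U`-large set on which a finitely-valued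
  sequence is constant) used for charts, exponents and certificate sizes.

Everything here is elementary (Mathlib has the constant-fibre version `Filter.Germ`; the walk data live in fields varying
with the level, hence the dependent product).  No `sorry`, standard axioms.
(Sources: Marker2002, Ex. 2.5.19–2.5.20 (ultraproducts, Łoś); vandenDriesSchmidt1984, §1.) [folklore]
-/


namespace Summit.ResolutionOfSingularities.ResolutionOfSingularities.Theorems.UltraWalk

/-! ## §1 A finitely-valued sequence is constant on a set of the ultrafilter -/

/-- A sequence with values in a FINITE type is constant `U`-almost everywhere, for an ultrafilter `U`. [folklore] -/
theorem Ultrafilter.exists_eventually_eq_of_finite {α : Type*} [Finite α] [Nonempty α] (U : Ultrafilter ℕ)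
    (f : ℕ → α) : ∃ a : α, ∀ᶠ B in (U : Filter ℕ), f B = a := by
  classical
  have hcov : (⋃ a ∈ (Set.univ : Set α), f ⁻¹' {a}) ∈ U := by
    have : (⋃ a ∈ (Set.univ : Set α), f ⁻¹' {a}) = Set.univ := by
      ext B; simp
    rw [this]; exact Filter.univ_mem
  obtain ⟨a, -, ha⟩ := (Ultrafilter.finite_biUnion_mem_iff Set.finite_univ).mp hcov
  exact ⟨a, ha⟩

/-- A sequence of naturals BOUNDED by `D` is constant `U`-almost everywhere. [folklore] -/
theorem Ultrafilter.exists_eventually_eq_of_le (U : Ultrafilter ℕ) {f : ℕ → ℕ} {D : ℕ} (hf : ∀ B, f B ≤ D) :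
    ∃ a : ℕ, a ≤ D ∧ ∀ᶠ B in (U : Filter ℕ), f B = a := by
  obtain ⟨a, ha⟩ := Ultrafilter.exists_eventually_eq_of_finite U (fun B => (⟨f B, Nat.lt_succ_of_le (hf B)⟩ : Fin (D + 1)))
  refine ⟨a, Nat.le_of_lt_succ a.2, ha.mono fun B hB => ?_⟩
  exact congrArg Fin.val hB

/-! ## §2 The null ideal and the ultraproduct field -/

section Field

variable (K : ℕ → Type) [∀ B, Field (K B)] (U : Ultrafilter ℕ)

/-- The ideal of families vanishing `U`-almost everywhere. DEFINITION (support). [folklore] -/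
def nullIdeal : Ideal (∀ B, K B) where
  carrier := {f | ∀ᶠ B in (U : Filter ℕ), f B = 0}
  zero_mem' := by simp
  add_mem' {f g} hf hg := by
    filter_upwards [hf, hg] with B hfB hgB
    simp [hfB, hgB]
  smul_mem' c {f} hf := by
    filter_upwards [hf] with B hfB
    simp [hfB]

variable {K U} in
/-- Membership in the null ideal. [folklore] -/
theorem mem_nullIdeal {f : ∀ B, K B} : f ∈ nullIdeal K U ↔ ∀ᶠ B in (U : Filter ℕ), f B = 0 := Iff.rfl

/-- The null ideal is MAXIMAL: a family that is non-zero on a set of `U` is invertible modulo it. [folklore] -/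
theorem nullIdeal_isMaximal : (nullIdeal K U).IsMaximal := by
  classical
  rw [Ideal.isMaximal_iff]
  refine ⟨?_, fun J f hJ hf hfJ => ?_⟩
  · intro h
    have h1 : ∀ᶠ B in (U : Filter ℕ), (1 : ∀ B, K B) B = 0 := h
    have : ∀ᶠ _B in (U : Filter ℕ), False := h1.mono fun B hB => one_ne_zero hB
    exact (Filter.eventually_false_iff_eq_bot.mp this |> fun h => U.neBot.ne h)
  · have hne : ∀ᶠ B in (U : Filter ℕ), f B ≠ 0 := Ultrafilter.eventually_not.mpr hf
    let g : ∀ B, K B := fun B => (f B)⁻¹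
    have hfg : f * g - 1 ∈ nullIdeal K U := by
      filter_upwards [hne] with B hB
      simp [g, mul_inv_cancel₀ hB]
    have h1 : (1 : ∀ B, K B) = f * g - (f * g - 1) := by ring
    rw [h1]
    exact J.sub_mem (J.mul_mem_right _ hfJ) (hJ hfg)

/-- The ULTRAPRODUCT `Π_U K_B`. DEFINITION (support). [folklore] -/
abbrev Ultra : Type := (∀ B, K B) ⧸ nullIdeal K U

/-- Maximal-ideal instance (a `Prop`). [folklore] -/
instance nullIdeal.isMaximal_inst : (nullIdeal K U).IsMaximal := nullIdeal_isMaximal K U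

/-- The ultraproduct is a FIELD (Mathlib's `Ideal.Quotient.field` at the maximal null ideal; it extends the quotient's
commutative-ring structure, no diamond). [folklore] -/
noncomputable instance Ultra.instField : Field (Ultra K U) := Ideal.Quotient.field (nullIdeal K U)

/-- The quotient map onto the ultraproduct. DEFINITION (support). [folklore] -/
abbrev Ultra.mk : (∀ B, K B) →+* Ultra K U := Ideal.Quotient.mk (nullIdeal K U)

variable {K U}

/-- ŁOŚ for equations: two families have the same class iff they agree `U`-almost everywhere. [folklore] -/
theorem Ultra.mk_eq_mk_iff {f g : ∀ B, K B} :
    Ultra.mk K U f = Ultra.mk K U g ↔ ∀ᶠ B in (U : Filter ℕ), f B = g B := by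
  rw [Ideal.Quotient.eq, mem_nullIdeal]
  exact Filter.eventually_congr (Filter.Eventually.of_forall fun B => by simp [sub_eq_zero])

/-- ŁOŚ for `= 0`. [folklore] -/
theorem Ultra.mk_eq_zero_iff {f : ∀ B, K B} :
    Ultra.mk K U f = 0 ↔ ∀ᶠ B in (U : Filter ℕ), f B = 0 := by
  rw [← map_zero (Ultra.mk K U), Ultra.mk_eq_mk_iff]; rfl

/-- ŁOŚ for `≠ 0` (uses that `U` is ULTRA). [folklore] -/
theorem Ultra.mk_ne_zero_iff {f : ∀ B, K B} :
    Ultra.mk K U f ≠ 0 ↔ ∀ᶠ B in (U : Filter ℕ), f B ≠ 0 := by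
  rw [Ne, Ultra.mk_eq_zero_iff, Ultrafilter.eventually_not]

/-- Every element of the ultraproduct is the class of a family. [folklore] -/
theorem Ultra.mk_surjective : Function.Surjective (Ultra.mk K U) := Ideal.Quotient.mk_surjective

/-- The ultraproduct of fields of characteristic `p` has characteristic `p`. [folklore] -/
theorem Ultra.charP (p : ℕ) [Fact p.Prime] [∀ B, CharP (K B) p] : CharP (Ultra K U) p := by
  rw [CharP.charP_iff_prime_eq_zero Fact.out]
  have : ((p : ∀ B, K B)) = 0 := by
    funext B; simp
  rw [← map_natCast (Ultra.mk K U), this, map_zero]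

/-- The ultraproduct of PERFECT fields of characteristic `p` is perfect (Frobenius lifts pointwise). [folklore] -/
theorem Ultra.perfectField (p : ℕ) [Fact p.Prime] [∀ B, CharP (K B) p] [∀ B, PerfectField (K B)] :
    PerfectField (Ultra K U) := by
  haveI : CharP (Ultra K U) p := Ultra.charP p
  haveI : PerfectRing (Ultra K U) p := by
    refine PerfectRing.ofSurjective _ p fun x => ?_
    obtain ⟨f, rfl⟩ := Ultra.mk_surjective x
    refine ⟨Ultra.mk K U fun B => (frobeniusEquiv (K B) p).symm (f B), ?_⟩
    rw [frobenius_def, ← map_pow]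
    congr 1
    funext B
    simp [frobeniusEquiv_symm_pow_p]
  exact PerfectRing.toPerfectField _ p

end Field

end Summit.ResolutionOfSingularities.ResolutionOfSingularities.Theorems.UltraWalk
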